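import Summits.Ventures.PercRepro.RankLevelSetCoreFiveTwentyNine
import Summits.Ventures.PercRepro.RankLevelSetCoreFour

/-!
# PercRepro — THE `e`-FREE CORE AT LEVEL `6`, EVERY CORANK `≥ 51`, EVERY RANK `p ≥ 52` (p8, S3)

`proofs/SUBCLAIM-S3-p8.md` §4. night-1's `c025_core_six_fortythree` (RankLevelSetCoreFour: `p ≥ 81`, corank `≥ 51`)
through p7's device `core_all_corank_of_bound_key` (RankLevelSetCoreFiveTwentyNine: regime I's threshold on `n` —
`n ≥ p + 51 ≥ 81` once `p ≥ 30` — and regime II's key `2^{p+6}·2^{37}·C(n, 6) ≤ C(p+6, p)·C(n, p − 1)` fed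
directly: decided at `n = 2p` for `52 ≤ p ≤ 63` (`key_six_two_mul_of_le_63`, twelve numerals; `p = 51` is FALSE —
`decide` refutes it), the crude criterion `P₂ = 64` beyond). Cells of the S3 map this closes: `(p, d)` with
`52 ≤ p ≤ 80`, `d ≥ 51`. Still open at corank `≥ 51`: `9 ≤ p ≤ 51`. Axioms: standard.
-/

open scoped Matroid

namespace PercRepro

namespace ThmN

variable {α : Type}

/-- The regime-II key at `q = 6`, `B = 43`, `n = 2p`, for `52 ≤ p ≤ 63` — twelve numerals, decided. -/
theorem key_six_two_mul_of_le_63 (p : ℕ) (hp : 52 ≤ p) (hp' : p ≤ 63) :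
    2 ^ (p + 6) * 2 ^ (43 - 6) * (2 * p).choose 6 ≤ (p + 6).choose p * (2 * p).choose (p - 1) := by
  interval_cases p <;> decide

/-- **The `e`-free core at level `6`, every corank `≥ 51`, every rank `p ≥ 52`** (`p ≥ 64`: the crude regime-II
criterion of `c025_core_six_fortythree`; `52 ≤ p ≤ 63`: the decided instances at `n = 2p`). -/
theorem c025_core_six_fortythree_fiftytwo (M : Matroid α) [M.Finite] (p : ℕ) (hp : 52 ≤ p)
    (hR : M.eRank = (p : ℕ∞)) (hbig : p + 50 < M.E.ncard)
    (hfree : ∀ e ∈ M.E, ∃ A ⊆ M.E \ {e}, e ∉ M.closure A ∧ e ∉ M.closure ((M.E \ {e}) \ A)) : RLS M p 6 := by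
  have hN₁ : ∀ n, 81 ≤ n → 8 * (6 + 1) * 2 ^ (43 - 6) * n ^ 6 ≤ 2 ^ n :=
    mul_pow_le_two_pow_of_base (8 * (6 + 1) * 2 ^ (43 - 6)) 6 81 (by norm_num) (by norm_num) (by norm_num)
  have hBj : ∀ j : ℕ, j ≤ 6 → ∀ X ⊆ M.E, M.eRk X ≤ j → X.ncard + 6 ≤ 43 + j := by
    intro j hj X hX hr
    rcases Nat.lt_or_ge j 4 with h | h
    · have := ncard_add_one_le_two_pow_of_eRk_le M (not_isLoop_of_free M hfree) hfree j X hX hr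
      interval_cases j <;> omega
    · rcases Nat.lt_or_ge j 5 with h5 | h5
      · have hj4 : j = 4 := by omega
        subst hj4
        have := ncard_le_ten_of_eRk_le_four_of_free M hfree hX hr
        omega
      · rcases Nat.lt_or_ge j 6 with h6 | h6
        · have hj5 : j = 5 := by omega
          subst hj5
          have := ncard_le_twentyone_of_eRk_le_five_of_free M hfree hX hr
          omega
        · have hj6 : j = 6 := by omega
          subst hj6
          have := ncard_le_fortythree_of_eRk_le_six_of_free M hfree hX hr
          omega
  have hkey : ∀ n, 2 * p ≤ n → 2 ^ (p + 6) * 2 ^ (43 - 6) * n.choose 6 ≤ (p + 6).choose p * n.choose (p - 1) := by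
    rcases Nat.lt_or_ge p 64 with h | h
    · exact regimeII_key_of_base p 6 (2 ^ (43 - 6)) ((p + 6).choose p) (2 * p) (by omega) (by omega) (by omega)
        (key_six_two_mul_of_le_63 p hp (by omega))
    · intro n hn
      have hP₂ := threshold_II_of_base 6 (2 ^ (43 - 6)) 64 (by norm_num) (by norm_num)
      exact choose_mul_le_choose_mul_of_threshold n p 6 (2 ^ (43 - 6)) (by omega) hn (hP₂ p h)
  exact core_all_corank_of_bound_key 6 43 (by norm_num) (by norm_num) 81 hN₁ M p (by omega) (by omega) hkey hR
    (by omega) hfree hBj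

end ThmN

end PercRepro
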